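import Summits.QuantumFields.BalabanUV.Beta.FP.TowerDoorGaugeCopies
import Summits.QuantumFields.BalabanUV.Beta.FP.TowerDoorUniformDataTorus
import Summits.QuantumFields.BalabanUV.Beta.FP.TorusNestedGaugeReadout
import Summits.QuantumFields.BalabanUV.Beta.NVertexWoundPeriodised

/-!
# `BalabanUV.Beta.FP.TowerDoorGaugePeriodised` — binder row D1, the row's ONE file, STUB P (P-c) (J-NOTE-20 §8∕§9 (2), SPEC-64 v3.2 §14 (3)(b)):
# **THE DOOR's TREE-GAUGE FUNCTION OF A SINGLE TOP SOURCE IS THE `Mc`-PERIODISATION OF THE LATTICE GAUGE FUNCTION `λℤ`** —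
# `lv (c • e_a) s = c · Σ'_m λℤ_(μ, w + Mc∘m)(↑s)` on every box, at the END wrapper's pins (`fN a = (wrapPt T (L•w), inr μ)`), composed BY NAME from road g53 (D)
# `gaugeParam_eq_neg_nestedReadout_sym` (the gauge parameter solves `(N·W₀)·θ = −N·X`), the leg letters `hLN hEAN` (the column `X` is the masked periodised chart column —
# PART 52's unwrapping, one source), leaf-06 G-2 (`det ≠ 0` ⇒ the solution is LINEAR in the column, so `θ = Σ'_m θ_m` copy by copy, pushed through the finite read-out), and road
# g54 (C6) `treeGauge_readout_eq_reference` ONCE PER COPY (the `hlve` word of `θ_m` on the box = the reference word = `−λℤ` of PART 55, the column agreement being the chart's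
# `L`-block covariance `shiftK (−L•t) A = A`)
# (β-function cell `pub-balaban`, BINDER-OWNERS row D1 ∕ (C1) OWNER «beta-an2» gen 77, PART 57 = STUB P (P-c) part 2 of 2; imports PART 56 `TowerDoorGaugeCopies` (the copy-by-copy bookkeeping
# over PART 55 + road (C6)) + PART 52 + road (D) + the row's `NVertexWoundPeriodised`)

WHAT ([folklore] `tsum`∕`HasSum` and finite `Matrix` bookkeeping BY NAME; no `def`, no `def … : Prop`, nothing cited, 0 sorry, default heartbeats; `d = 3`).
§4 **`hasSum_lamZ_treeGauge_readout`** ∕ **`lv_smul_single_eq_tsum_lamZ`** — at (C6)'s letters on the box `M′` (generic root list; G-2's `det ≠ 0` displayed on the box AND on the reference tower), the leg letters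
`hLN hEAN` for an `L`-block covariant kernel `A` with summable source copies, the coarse box `Mc` (`M′ = Lc • Mc`), ONE slot pin `hfa : fN a = (wrapPt T (L • w), inr μ)` and a displayed (D)-equation `hθ` for the
data `c • Pi.single a 1`: `HasSum (m ↦ c * lamZ … A μ (translate Mc w m) ↑s) (−Σ_x [x.1 = s]·(E *ᵥ θ)(towerEquiv x))` (PART 56: the column series `toBlocks₁₂_mulVec_smul_single` + `leg12_of_hLN` +
`mask_apply_eq_of_hEA` + `hasSum_perF_inl_source`, then `hasSum_gaugeParam`, `hasSum_readout`, and `treeGauge_readout_eq_neg_lamZ` per copy); with v10's `hlve` display, `lv (c • Pi.single a 1) s = c * Σ'_m λℤ`.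
§5 **`lv_smul_single_eq_tsum_lamZ_at_pins`** — AT (D) §2's BINDERS VERBATIM (as PART 54 §2) + `Mc hMc σ ρN LNc fN` + ONE slot pin `hfa` + v10's `hlve` display:
`lv (c • Pi.single a 1) s = c * Σ'_m lamZ Lc lev (fun _ => ctrOff 4 Lc) _ n (scaleK σ σ (AN R (n+1))) μ (translate Mc w m) ↑s` for the record's chart (its `L`-block covariance = the row's `shiftK_AN` —
`shiftK_scaleK_AN`; its copy summability = PART 52 `summable_scaleK_AN_inl_inr_sources` ∘ `Summable.comp_injective` — `summable_scaleK_AN_inl_inr_copies`), the (D)-equation by road (D)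
`gaugeParam_eq_neg_nestedReadout_sym` BY NAME, G-2 on the reference tower DISCHARGED (PART 55 `det_refSlice_mul_towerGen_ne_zero`).  At v10's slots (`a = (wrapPt (Mc B) y, μ)`, `hfa := hfN n B a`,
`w = wrap (Mc B) y`) the copies re-index from the wrapped source to the raw one by the TREE's `FP/TowerHLinkRows.tsum_translate_wrap_eq` (`Σ'_m F (translate S (wrap S y) m) = Σ'_m F (translate S y m)`; chair
leaf-03 g64 XV2 DOCFIX-1 — not restated here).
WHAT THIS IS NOT: not the lattice `hΘ`; not (T2)'s `perF_comp` bookkeeping; the door NOT defined; `hlve`, `h1 h2`, G-2's `det` on the box, the leg letters and g39's pins remain DISPLAYED (their dischargers are the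
wrapper's ∕ leaf-06's ∕ road's, by name); nothing of Bałaban's asserted, valued or discharged; 0 estimates; 0∕4 row-D1 binders (hW, hR, D1Tel, D1Rep); v10 NOT filed; v9 p617999 stands; NOT (C1), NOT (T-ID),
NOT D1, NEVER «G-an2-4 closed», NOT BetaPertH, NOT continuum, NOT Clay.

HONEST DEPENDENCY (page 1, mandatory): continuum YM on T⁴ ⇐ BetaPertH ∧ nine spine estimates (0/9 proved); BetaPertH ⇐ (D1) ∧ (D4) ∧ CAP+tail;
G-an2-4 gates asym, D1 and NE2/3/4.  HONEST FRAMING (cell contract, verbatim): «discharging `BetaPertH` makes Bałaban's UV stability UNCONDITIONAL —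
a real constructive-QFT result; it is NOT the continuum limit and NOT the Clay problem.»  ABSOLUTE RULE (cell charter, verbatim): «No internally-minted
statement may enter as a cited fact. Every hypothesis is either kernel-proved in this package or a verbatim quotation of a PUBLISHED theorem with page
reference. The manuscript(s) under audit are NOT citable for their own disputed steps — they are the thing under adjudication; programme-internal
(2001/route/tribunal) claims are never citable.»  Row D1 ∕ (C1) OWNER «beta-an2» gen 77, 2026-08-29.  No existing file touched.
-/

noncomputable section

open Finset Matrix
open scoped BigOperators
open Literature.Probability.LatticeModels (Torus.proj)
open Literature.MathematicalPhysics.QuantumFieldTheory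
open Literature.MathematicalPhysics.QuantumFieldTheory.Balaban1983to89
open Literature.MathematicalPhysics.QuantumFieldTheory.Balaban1983to89.Beta
open Literature.MathematicalPhysics.QuantumFieldTheory.Balaban1983to89.Beta.Composition (kkt)
open Literature.MathematicalPhysics.QuantumFieldTheory.Balaban1983to89.Beta.CompositionSingular (effForm minOp)
open B4TorusKernel.MultiPeriod (translate translate_injective)
open B4Reflection242 (translate_translate)
open B5Prop11Plancherel (fine)
open B6Lemma24Torus (pbox wrap)
open AffineAveraging (Site box toSite unitVec)
open AveragingContoursRooted (ctrOff ctrOff_mem_box)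
open OneStepResolventKernel (Fib)
open ExpKernelCalculus (MKer shiftK)
open HessKerRate (scaleK scaleK_apply)
open Literature.MathematicalPhysics.QuantumFieldTheory.LatticeForm (quo)
open Summit.QuantumFields.BalabanUV.Beta.AxialDressingRooted (axEc)
open Summit.QuantumFields.BalabanUV.Beta.SymShiftedSpread (bhKStepSh)
open Summit.QuantumFields.BalabanUV.Beta.DshAn1 (Dsh)
open Summit.QuantumFields.BalabanUV.Beta.CompositeOneShotJetData (Roots AN AN_eq)
open Summit.QuantumFields.BalabanUV.Beta.NVertexWoundPeriodised (shiftK_AN)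
open Summit.QuantumFields.BalabanUV.Beta.FP.KernelPeriodisationFib (Idx perF perZ perF_apply perZ_apply)
open Summit.QuantumFields.BalabanUV.Beta.FP.TorusGaugeCovariancePairing (wrapPt wrapPt_coe)
open Summit.QuantumFields.BalabanUV.Beta.FP.TorusCombRows (Res)
open Summit.QuantumFields.BalabanUV.Beta.FP.TorusCompositeObjects (towerTorus towerTorus_apply NParam combF bigP towerGen bigRoot bigRatio bigRatio_eq_pow towerEquiv)
open Summit.QuantumFields.BalabanUV.Beta.FP.TorusCompositeObjectsG (compRowsSym)
open Summit.QuantumFields.BalabanUV.Beta.FP.TorusCompositeUnimodular (towerEvalC)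
open Summit.QuantumFields.BalabanUV.Beta.GAN24.FineReadoutCauchyFrame (toSite_mem_range)
open Summit.QuantumFields.BalabanUV.Beta.FP.TowerK2bDoorReadoutPeriodised (wrap_eq_translate_neg_quo translate_smul_eq_smul_translate)
open Summit.QuantumFields.BalabanUV.Beta.FP.TowerDoorUniformDataTorus (summable_scaleK_AN_inl_inr_sources)
open Summit.QuantumFields.BalabanUV.Beta.FP.TorusWJunctionOfNLeg (leg12_of_hLN mask_apply_eq_of_hEA)
open Summit.QuantumFields.BalabanUV.Beta.FP.TorusNestedGaugeReadout (gaugeParam_eq_neg_nestedReadout_sym)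
open Summit.QuantumFields.BalabanUV.Beta.FP.TorusReferenceBlock (sub_zsmul_quo_mem_pbox_ref treeGauge_readout_eq_reference)
open Summit.QuantumFields.BalabanUV.Beta.FP.TowerDoorGaugeRefDefs

open Summit.QuantumFields.BalabanUV.Beta.FP.TowerDoorGaugeCopies

namespace Summit.QuantumFields.BalabanUV.Beta.FP.TowerDoorGaugePeriodised

variable {d : ℕ}

/-! ## §4 Assembly at (C6)'s letters + the leg letters: `lv (c • e_a) s = c · Σ'_m λℤ` -/

section Assembly

variable (Lc : ℕ) [NeZero Lc] (M' : Fin (3 + 1) → ℕ) [∀ μ, NeZero (M' μ)] (lev : ℕ → ℕ) (rs : ℕ → (Fin (3 + 1) → ℕ))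
  (hrs : ∀ k i, 0 ≤ toSite (rs k) i ∧ toSite (rs k) i < (Lc : ℤ)) (hM' : ∀ i, Lc ∣ M' i) (n : ℕ)
include hM'

/-- [folklore] **`hasSum_lamZ_treeGauge_readout`** — at (C6)'s letters on the box `M′` (generic root list; `det ≠ 0` displayed on the box and on the reference tower), the leg letters `hLN hEAN` for an
`L`-block covariant kernel `A` with summable source copies, the coarse box `Mc` (`M′ = Lc • Mc`, so `T = L • Mc`), ONE slot pin `hfa : fN a = (wrapPt T (L•w), inr μ)`, and a displayed (D)-equation for the
data `c • Pi.single a 1`: the `hlve` word of `θ` is the series `Σ'_m −c·λℤ_(μ, translate Mc w m)(↑s)`: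
`HasSum (m ↦ c * lamZ … A μ (translate Mc w m) ↑s) (−Σ_x [x.1 = s]·(E *ᵥ θ)(towerEquiv x))`. -/
theorem hasSum_lamZ_treeGauge_readout
    {Q₁₀ : Matrix (↥(pbox M') × Fin (3 + 1)) (↥(pbox (towerTorus Lc M' (n + 1))) × Fin (3 + 1)) ℝ} (hQ₁₀ : Q₁₀ = compRowsSym Lc M' lev rs (n + 1))
    {τ₁ : Matrix (NParam Lc (fine Lc M') (fun k => rs (k + 1)) n) (↥(pbox (towerTorus Lc M' (n + 1))) × Fin (3 + 1)) ℝ}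
    (hτ₁ : τ₁ = bigP Lc (fine Lc M') (fun k => rs (k + 1)) (fun k => hrs (k + 1)) n)
    {τ₂ : Matrix (Res (toSite (rs 0)) Lc M') (↥(pbox M') × Fin (3 + 1)) ℝ} (hτ₂ : τ₂ = combF Lc M' (rs 0))
    {N : Matrix (NParam Lc M' rs (n + 1)) (↥(pbox (towerTorus Lc M' (n + 1))) × Fin (3 + 1)) ℝ} (hN : N = Matrix.fromRows (τ₂ * Q₁₀) τ₁)
    {W₀ : Matrix (↥(pbox (towerTorus Lc M' (n + 1))) × Fin (3 + 1)) (NParam Lc M' rs (n + 1)) ℝ} (hW₀ : W₀ = towerGen Lc M' rs (n + 1))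
    {E : Matrix (NParam Lc M' rs (n + 1)) (NParam Lc M' rs (n + 1)) ℝ} (hE : E = towerEvalC Lc M' rs hrs (n + 1))
    (hTW : (N * W₀).det ≠ 0)
    (hTW' : (refSlice Lc lev rs hrs n * towerGen Lc (fun _ : Fin (3 + 1) => Lc) rs (n + 1)).det ≠ 0)
    -- the coarse box and the leg letters for a block-covariant chart with summable source copies
    (Mc : Fin (3 + 1) → ℕ) [∀ i, NeZero (Mc i)] (hMc : ∀ i, M' i = Lc * Mc i)
    {κs ρs : Type*} [Fintype κs] [Fintype ρs] [DecidableEq κs] (ρN : Site (3 + 1)) (LNc : ℕ) (A : MKer (3 + 1) (Fib 3))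
    (hA : ∀ t : Site (3 + 1), shiftK (-(((bigRatio Lc (n + 1) : ℕ) : ℤ) • t)) A = A)
    (hAs : ∀ (x : Site (3 + 1)) (κ μ : Fin (3 + 1)) (w : Site (3 + 1)),
      Summable (fun m : Site (3 + 1) => A x (((bigRatio Lc (n + 1) : ℕ) : ℤ) • translate Mc w m) (Sum.inl κ) (Sum.inr μ)))
    (fN : κs → Idx (towerTorus Lc M' (n + 1)) (Fib 3))
    {XN : Matrix ((↥(pbox (towerTorus Lc M' (n + 1))) × Fin (3 + 1)) ⊕ (κs ⊕ ρs)) ((↥(pbox (towerTorus Lc M' (n + 1))) × Fin (3 + 1)) ⊕ (κs ⊕ ρs)) ℝ}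
    (hEAN : perF (towerTorus Lc M' (n + 1)) (axEc ρN LNc) * perF (towerTorus Lc M' (n + 1)) A = perF (towerTorus Lc M' (n + 1)) A)
    (hLN : XN.submatrix (Sum.map id Sum.inl) (Sum.map id Sum.inl) = fromBlocks
      (Matrix.of fun (b b' : (↥(pbox (towerTorus Lc M' (n + 1))) × Fin (3 + 1))) =>
        axEc ρN LNc (b.1 : Site (3 + 1)) (b.1 : Site (3 + 1)) (Sum.inl b.2) (Sum.inl b.2)
          * (axEc ρN LNc (b'.1 : Site (3 + 1)) (b'.1 : Site (3 + 1)) (Sum.inl b'.2) (Sum.inl b'.2)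
            * perF (towerTorus Lc M' (n + 1)) A (b.1, Sum.inl b.2) (b'.1, Sum.inl b'.2)))
      (Matrix.of fun (b : (↥(pbox (towerTorus Lc M' (n + 1))) × Fin (3 + 1))) (a : κs) =>
        axEc ρN LNc (b.1 : Site (3 + 1)) (b.1 : Site (3 + 1)) (Sum.inl b.2) (Sum.inl b.2) * perF (towerTorus Lc M' (n + 1)) A (b.1, Sum.inl b.2) (fN a))
      (-Matrix.of fun (a : κs) (b : (↥(pbox (towerTorus Lc M' (n + 1))) × Fin (3 + 1))) =>
        axEc ρN LNc (b.1 : Site (3 + 1)) (b.1 : Site (3 + 1)) (Sum.inl b.2) (Sum.inl b.2) * perF (towerTorus Lc M' (n + 1)) A (fN a) (b.1, Sum.inl b.2))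
      (-((perF (towerTorus Lc M' (n + 1)) A).submatrix fN fN)))
    -- ONE slot pin: the source `a` sits at the coarse lattice site `w`, leg `μ`
    (a : κs) (w : Site (3 + 1)) (μ : Fin (3 + 1))
    (hfa : fN a = (wrapPt (towerTorus Lc M' (n + 1)) (((bigRatio Lc (n + 1) : ℕ) : ℤ) • w), Sum.inr μ)) (c : ℝ)
    {θ : NParam Lc M' rs (n + 1) → ℝ}
    (hθ : (N * W₀) *ᵥ θ = -(N *ᵥ (XN.toBlocks₁₂ *ᵥ Sum.elim (c • (Pi.single a (1 : ℝ) : κs → ℝ)) (fun _ : ρs => 0))))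
    (s : ↥(pbox (towerTorus Lc M' (n + 1)))) :
    HasSum (fun m : Site (3 + 1) => c * lamZ Lc lev rs hrs n A μ (translate Mc w m) (s : Site (3 + 1)))
      (-(∑ x : Res (bigRoot Lc rs (n + 1)) (bigRatio Lc (n + 1)) (towerTorus Lc M' (n + 1)),
          (if (x.1 : ↥(pbox (towerTorus Lc M' (n + 1)))) = s then (E *ᵥ θ) (towerEquiv Lc M' rs hrs (n + 1) x) else 0))) := by
  have hT : ∀ i, towerTorus Lc M' (n + 1) i = bigRatio Lc (n + 1) * Mc i := fun i => by
    rw [towerTorus_apply, hMc i, bigRatio_eq_pow]; ring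
  -- the copies of the lattice column and their series = the one-shot column of the data
  set Xm : Site (3 + 1) → (↥(pbox (towerTorus Lc M' (n + 1))) × Fin (3 + 1) → ℝ) := fun m b =>
    A (b.1 : Site (3 + 1)) (((bigRatio Lc (n + 1) : ℕ) : ℤ) • translate Mc w m) (Sum.inl b.2) (Sum.inr μ) with hXm
  have hX : HasSum (fun m => c • Xm m) (XN.toBlocks₁₂ *ᵥ Sum.elim (c • (Pi.single a (1 : ℝ) : κs → ℝ)) (fun _ : ρs => 0)) := by
    rw [Pi.hasSum]
    intro b
    rw [toBlocks₁₂_mulVec_smul_single, leg12_of_hLN (towerTorus Lc M' (n + 1)) ρN LNc A fN hLN b a,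
      mask_apply_eq_of_hEA (towerTorus Lc M' (n + 1)) ρN LNc A hEAN (b.1, Sum.inl b.2) (fN a), hfa]
    simp only [Pi.smul_apply, smul_eq_mul, hXm]
    exact (hasSum_perF_inl_source (bigRatio Lc (n + 1)) (towerTorus Lc M' (n + 1)) Mc hT A b.1 b.2 μ w (hAs (b.1 : Site (3 + 1)) b.2 μ w)).mul_left c
  -- the gauge parameter copy by copy, and its read-out
  have hθs := hasSum_gaugeParam hTW hθ hX
  have hr := hasSum_readout E (fun x : Res (bigRoot Lc rs (n + 1)) (bigRatio Lc (n + 1)) (towerTorus Lc M' (n + 1)) => (x.1 : ↥(pbox (towerTorus Lc M' (n + 1)))))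
    (towerEquiv Lc M' rs hrs (n + 1)) s hθs
  -- each copy's read-out is `−c·λℤ`
  have e : ∀ m : Site (3 + 1),
      (∑ x : Res (bigRoot Lc rs (n + 1)) (bigRatio Lc (n + 1)) (towerTorus Lc M' (n + 1)),
        (if (x.1 : ↥(pbox (towerTorus Lc M' (n + 1)))) = s then (E *ᵥ (-((N * W₀)⁻¹ *ᵥ (N *ᵥ (c • Xm m))))) (towerEquiv Lc M' rs hrs (n + 1) x) else 0))
        = -(c * lamZ Lc lev rs hrs n A μ (translate Mc w m) (s : Site (3 + 1))) := by
    intro m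
    rw [neg_inv_mulVec_smul, readout_smul, treeGauge_readout_eq_neg_lamZ Lc M' lev rs hrs hM' n hQ₁₀ hτ₁ hτ₂ hN hW₀ hE hTW hTW' A hA μ (translate Mc w m)
      (mul_mulVec_neg_inv hTW (Xm m)) s, mul_neg]
  simp_rw [e] at hr
  simpa using hr.neg

/-- [folklore] **`lv_smul_single_eq_tsum_lamZ`** — the same with v10's `hlve`-shaped DISPLAY of the tree-gauge function (`lv v s = −Σ_x [x.1 = s]·(E *ᵥ θ_v)(towerEquiv x)` for the displayed `θ_v`):
`lv (c • Pi.single a 1) s = c * Σ'_m lamZ … A μ (translate Mc w m) ↑s`. -/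
theorem lv_smul_single_eq_tsum_lamZ
    {Q₁₀ : Matrix (↥(pbox M') × Fin (3 + 1)) (↥(pbox (towerTorus Lc M' (n + 1))) × Fin (3 + 1)) ℝ} (hQ₁₀ : Q₁₀ = compRowsSym Lc M' lev rs (n + 1))
    {τ₁ : Matrix (NParam Lc (fine Lc M') (fun k => rs (k + 1)) n) (↥(pbox (towerTorus Lc M' (n + 1))) × Fin (3 + 1)) ℝ}
    (hτ₁ : τ₁ = bigP Lc (fine Lc M') (fun k => rs (k + 1)) (fun k => hrs (k + 1)) n)
    {τ₂ : Matrix (Res (toSite (rs 0)) Lc M') (↥(pbox M') × Fin (3 + 1)) ℝ} (hτ₂ : τ₂ = combF Lc M' (rs 0))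
    {N : Matrix (NParam Lc M' rs (n + 1)) (↥(pbox (towerTorus Lc M' (n + 1))) × Fin (3 + 1)) ℝ} (hN : N = Matrix.fromRows (τ₂ * Q₁₀) τ₁)
    {W₀ : Matrix (↥(pbox (towerTorus Lc M' (n + 1))) × Fin (3 + 1)) (NParam Lc M' rs (n + 1)) ℝ} (hW₀ : W₀ = towerGen Lc M' rs (n + 1))
    (hTW : (N * W₀).det ≠ 0)
    (hTW' : (refSlice Lc lev rs hrs n * towerGen Lc (fun _ : Fin (3 + 1) => Lc) rs (n + 1)).det ≠ 0)
    (Mc : Fin (3 + 1) → ℕ) [∀ i, NeZero (Mc i)] (hMc : ∀ i, M' i = Lc * Mc i)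
    {κs ρs : Type*} [Fintype κs] [Fintype ρs] [DecidableEq κs] (ρN : Site (3 + 1)) (LNc : ℕ) (A : MKer (3 + 1) (Fib 3))
    (hA : ∀ t : Site (3 + 1), shiftK (-(((bigRatio Lc (n + 1) : ℕ) : ℤ) • t)) A = A)
    (hAs : ∀ (x : Site (3 + 1)) (κ μ : Fin (3 + 1)) (w : Site (3 + 1)),
      Summable (fun m : Site (3 + 1) => A x (((bigRatio Lc (n + 1) : ℕ) : ℤ) • translate Mc w m) (Sum.inl κ) (Sum.inr μ)))
    (fN : κs → Idx (towerTorus Lc M' (n + 1)) (Fib 3))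
    {XN : Matrix ((↥(pbox (towerTorus Lc M' (n + 1))) × Fin (3 + 1)) ⊕ (κs ⊕ ρs)) ((↥(pbox (towerTorus Lc M' (n + 1))) × Fin (3 + 1)) ⊕ (κs ⊕ ρs)) ℝ}
    (hEAN : perF (towerTorus Lc M' (n + 1)) (axEc ρN LNc) * perF (towerTorus Lc M' (n + 1)) A = perF (towerTorus Lc M' (n + 1)) A)
    (hLN : XN.submatrix (Sum.map id Sum.inl) (Sum.map id Sum.inl) = fromBlocks
      (Matrix.of fun (b b' : (↥(pbox (towerTorus Lc M' (n + 1))) × Fin (3 + 1))) =>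
        axEc ρN LNc (b.1 : Site (3 + 1)) (b.1 : Site (3 + 1)) (Sum.inl b.2) (Sum.inl b.2)
          * (axEc ρN LNc (b'.1 : Site (3 + 1)) (b'.1 : Site (3 + 1)) (Sum.inl b'.2) (Sum.inl b'.2)
            * perF (towerTorus Lc M' (n + 1)) A (b.1, Sum.inl b.2) (b'.1, Sum.inl b'.2)))
      (Matrix.of fun (b : (↥(pbox (towerTorus Lc M' (n + 1))) × Fin (3 + 1))) (a : κs) =>
        axEc ρN LNc (b.1 : Site (3 + 1)) (b.1 : Site (3 + 1)) (Sum.inl b.2) (Sum.inl b.2) * perF (towerTorus Lc M' (n + 1)) A (b.1, Sum.inl b.2) (fN a))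
      (-Matrix.of fun (a : κs) (b : (↥(pbox (towerTorus Lc M' (n + 1))) × Fin (3 + 1))) =>
        axEc ρN LNc (b.1 : Site (3 + 1)) (b.1 : Site (3 + 1)) (Sum.inl b.2) (Sum.inl b.2) * perF (towerTorus Lc M' (n + 1)) A (fN a) (b.1, Sum.inl b.2))
      (-((perF (towerTorus Lc M' (n + 1)) A).submatrix fN fN)))
    (a : κs) (w : Site (3 + 1)) (μ : Fin (3 + 1))
    (hfa : fN a = (wrapPt (towerTorus Lc M' (n + 1)) (((bigRatio Lc (n + 1) : ℕ) : ℤ) • w), Sum.inr μ)) (c : ℝ)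
    -- the displayed gauge parameter of the data and v10's `hlve`-shaped read-out
    (θv : (κs → ℝ) → (NParam Lc M' rs (n + 1) → ℝ))
    (hθ : (N * W₀) *ᵥ θv (c • (Pi.single a (1 : ℝ) : κs → ℝ)) = -(N *ᵥ (XN.toBlocks₁₂ *ᵥ Sum.elim (c • (Pi.single a (1 : ℝ) : κs → ℝ)) (fun _ : ρs => 0))))
    (lv : (κs → ℝ) → (↥(pbox (towerTorus Lc M' (n + 1))) → ℝ))
    (hlve : ∀ (v : κs → ℝ) (s : ↥(pbox (towerTorus Lc M' (n + 1)))), lv v s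
      = -(∑ x : Res (bigRoot Lc rs (n + 1)) (bigRatio Lc (n + 1)) (towerTorus Lc M' (n + 1)),
          (if (x.1 : ↥(pbox (towerTorus Lc M' (n + 1)))) = s then
            (towerEvalC Lc M' rs hrs (n + 1) *ᵥ θv v) (towerEquiv Lc M' rs hrs (n + 1) x) else 0)))
    (s : ↥(pbox (towerTorus Lc M' (n + 1)))) :
    lv (c • (Pi.single a (1 : ℝ) : κs → ℝ)) s = c * ∑' m : Site (3 + 1), lamZ Lc lev rs hrs n A μ (translate Mc w m) (s : Site (3 + 1)) := by
  rw [hlve, ← tsum_mul_left]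
  exact ((hasSum_lamZ_treeGauge_readout Lc M' lev rs hrs hM' n hQ₁₀ hτ₁ hτ₂ hN hW₀ rfl hTW hTW' Mc hMc ρN LNc A hA hAs fN hEAN hLN a w μ hfa c hθ s).tsum_eq).symm

end Assembly

/-! ## §5 At (D) §2's pins, for the record's chart `σ·AN·σ`: block covariance and summability discharged, G-2 on the reference tower discharged -/

section Record

variable {Lc : ℕ} [NeZero Lc] (R : Roots Lc)

/-- [folklore] the `σ`-conjugated chart at door index `j` is `Lc^(j+1)`-block covariant (the row's `shiftK_AN`; `scaleK` is by constants). -/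
theorem shiftK_scaleK_AN (j : ℕ) (u v : Fib 3 → ℝ) (t : Site (3 + 1)) :
    shiftK (-(((Lc ^ (j + 1) : ℕ) : ℤ) • t)) (scaleK u v (AN R j)) = scaleK u v (AN R j) := by
  have h := shiftK_AN R j 0 t
  rw [← AN_eq] at h
  funext x y a b
  simp only [shiftK, scaleK_apply] at h ⊢
  rw [show AN R j (x + -(((Lc ^ (j + 1) : ℕ) : ℤ) • t)) (y + -(((Lc ^ (j + 1) : ℕ) : ℤ) • t)) a b = AN R j x y a b from
    congrFun (congrFun (congrFun (congrFun h x) y) a) b]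

/-- [folklore] the source copies of the `σ`-conjugated chart's field–multiplier columns are summable (PART 52 over all coarse sites ∘ `Summable.comp_injective` along `m ↦ translate Mc w m`). -/
theorem summable_scaleK_AN_inl_inr_copies (j : ℕ) (u v : Fib 3 → ℝ) (Mc : Fin (3 + 1) → ℕ) [∀ i, NeZero (Mc i)]
    (x : Site (3 + 1)) (κ μ : Fin (3 + 1)) (w : Site (3 + 1)) :
    Summable (fun m : Site (3 + 1) => scaleK u v (AN R j) x (((Lc ^ (j + 1) : ℕ) : ℤ) • translate Mc w m) (Sum.inl κ) (Sum.inr μ)) :=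
  (summable_scaleK_AN_inl_inr_sources R j u v x κ μ).comp_injective
    (translate_injective (N := Mc) (fun i => Nat.one_le_iff_ne_zero.mpr (NeZero.ne (Mc i))) w)

variable (M' : Fin (3 + 1) → ℕ) [∀ μ, NeZero (M' μ)] (Lc) (lev : ℕ → ℕ) (n : ℕ)

set_option synthInstance.maxSize 1024 in
/-- [folklore] **`lv_smul_single_eq_tsum_lamZ_at_pins` — STUB P (P-c) AT THE END WRAPPER's PINS: THE DOOR's GAUGE FUNCTION IS THE PERIODISED LATTICE GAUGE FUNCTION.**  Binders = road g53 (D)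
`gaugeParam_eq_neg_nestedReadout_sym`'s VERBATIM (`d = 3`) + leaf-06 G-2's `det ≠ 0` on the box + the leg letters `hEAN hLN` for the record's chart `scaleK σ σ (AN R (n+1))` + the coarse box `Mc` (`M′ = Lc • Mc`,
`hMc`) + ONE slot pin `hfa : fN a = (wrapPt T (L • w), inr μ)` (v10: `hfN n B a`, `w = ↑a.1`, `μ = a.2`) + v10's `hlve` display; conclusion:
`lv (c • Pi.single a 1) s = c * Σ'_m lamZ Lc lev ρc∗ ρc∈ n (scaleK σ σ (AN R (n+1))) μ (translate Mc w m) ↑s` — G-2 on the reference tower is PART 55 `det_refSlice_mul_towerGen_ne_zero` (no hypothesis). -/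
theorem lv_smul_single_eq_tsum_lamZ_at_pins
    (hrs : ∀ _k : ℕ, ctrOff (3 + 1) Lc ∈ box (3 + 1) Lc)
    (hlev : ∀ i, i ≤ n → lev i = lev (i + 1) + 1) (hM' : ∀ i, Lc ∣ M' i)
    {κ : Type*} [Fintype κ] [DecidableEq κ] (pμ' : κ → ↥(pbox M')) (mμ' : κ → Fin (3 + 1))
    (hfμ' : Function.Injective (fun a : κ => ((pμ' a, Sum.inr (mμ' a)) : Idx M' (Fib 3))))
    (hcoarse' : ∀ (s : ↥(pbox M')) (m : Fin (3 + 1)),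
      ((s, Sum.inr m) : Idx M' (Fib 3)) ∈ Set.range (fun a : κ => ((pμ' a, Sum.inr (mμ' a)) : Idx M' (Fib 3))) ↔ Torus.proj Lc (s : Site (3 + 1)) = 0)
    {H₀ : Matrix (↥(pbox (towerTorus Lc M' (n + 1))) × Fin (3 + 1)) (↥(pbox (towerTorus Lc M' (n + 1))) × Fin (3 + 1)) ℝ}
    {Q₁₀ : Matrix (↥(pbox M') × Fin (3 + 1)) (↥(pbox (towerTorus Lc M' (n + 1))) × Fin (3 + 1)) ℝ}
    {τ₁ : Matrix (NParam Lc (fine Lc M') (fun k => (fun _ : ℕ => ctrOff (3 + 1) Lc) (k + 1)) n) (↥(pbox (towerTorus Lc M' (n + 1))) × Fin (3 + 1)) ℝ}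
    (hH₀ : H₀ = (perF (towerTorus Lc M' (n + 1)) (bhKStepSh 3 Lc (Dsh Lc) (lev (n + 1)))).submatrix
        (fun b : ↥(pbox (towerTorus Lc M' (n + 1))) × Fin (3 + 1) => ((b.1, Sum.inl b.2) : Idx (towerTorus Lc M' (n + 1)) (Fib 3)))
        (fun b : ↥(pbox (towerTorus Lc M' (n + 1))) × Fin (3 + 1) => ((b.1, Sum.inl b.2) : Idx (towerTorus Lc M' (n + 1)) (Fib 3))))
    (hQ₁₀ : Q₁₀ = compRowsSym Lc M' lev (fun _ : ℕ => ctrOff (3 + 1) Lc) (n + 1))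
    (hτ₁ : τ₁ = bigP Lc (fine Lc M') (fun k => (fun _ : ℕ => ctrOff (3 + 1) Lc) (k + 1)) (fun k => toSite_mem_range (hrs (k + 1))) n)
    {τ₂ : Matrix (Res (toSite (ctrOff (3 + 1) Lc)) Lc M') (↥(pbox M') × Fin (3 + 1)) ℝ} (hτ₂ : τ₂ = combF Lc M' ((fun _ : ℕ => ctrOff (3 + 1) Lc) 0))
    {Q₂₀ : Matrix κ (↥(pbox M') × Fin (3 + 1)) ℝ}
    (hQ₂₀ : Q₂₀ = (perF M' (bhKStepSh 3 Lc (Dsh Lc) (lev 0))).submatrix (fun a : κ => ((pμ' a, Sum.inr (mμ' a)) : Idx M' (Fib 3)))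
        (fun b : ↥(pbox M') × Fin (3 + 1) => ((b.1, Sum.inl b.2) : Idx M' (Fib 3))))
    {W₀ : Matrix (↥(pbox (towerTorus Lc M' (n + 1))) × Fin (3 + 1)) (NParam Lc M' (fun _ : ℕ => ctrOff (3 + 1) Lc) (n + 1)) ℝ}
    (hW₀ : W₀ = towerGen Lc M' (fun _ : ℕ => ctrOff (3 + 1) Lc) (n + 1))
    {P : Matrix (NParam Lc M' (fun _ : ℕ => ctrOff (3 + 1) Lc) (n + 1)) (↥(pbox (towerTorus Lc M' (n + 1))) × Fin (3 + 1)) ℝ}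
    (hP : P = bigP Lc M' (fun _ : ℕ => ctrOff (3 + 1) Lc) (fun k => toSite_mem_range (hrs k)) (n + 1))
    {𝔔₀ : Matrix κ (↥(pbox (towerTorus Lc M' (n + 1))) × Fin (3 + 1)) ℝ} (h𝔔₀ : Q₂₀ * Q₁₀ = 𝔔₀)
    {I : Matrix (↥(pbox (towerTorus Lc M' (n + 1))) × Fin (3 + 1))
      ((↥(pbox M') × Fin (3 + 1)) ⊕ NParam Lc (fine Lc M') (fun k => (fun _ : ℕ => ctrOff (3 + 1) Lc) (k + 1)) n) ℝ}
    {S : Matrix ((↥(pbox M') × Fin (3 + 1)) ⊕ NParam Lc (fine Lc M') (fun k => (fun _ : ℕ => ctrOff (3 + 1) Lc) (k + 1)) n)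
      ((↥(pbox M') × Fin (3 + 1)) ⊕ NParam Lc (fine Lc M') (fun k => (fun _ : ℕ => ctrOff (3 + 1) Lc) (k + 1)) n) ℝ}
    (hI : minOp H₀ (fromRows Q₁₀ τ₁) = I) (hS : effForm H₀ (fromRows Q₁₀ τ₁) = S)
    {hv : (κ → ℝ) → ((↥(pbox (towerTorus Lc M' (n + 1))) × Fin (3 + 1)) → ℝ)}
    (hhv : ∀ v, hv v = I *ᵥ Sum.elim (minOp S.toBlocks₁₁ (fromRows Q₂₀ τ₂) *ᵥ Sum.elim v 0) 0)
    {XN : Matrix ((↥(pbox (towerTorus Lc M' (n + 1))) × Fin (3 + 1)) ⊕ (κ ⊕ NParam Lc M' (fun _ : ℕ => ctrOff (3 + 1) Lc) (n + 1)))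
      ((↥(pbox (towerTorus Lc M' (n + 1))) × Fin (3 + 1)) ⊕ (κ ⊕ NParam Lc M' (fun _ : ℕ => ctrOff (3 + 1) Lc) (n + 1))) ℝ}
    (hXN : kkt H₀ (fromRows 𝔔₀ P) * XN = 1) 
    -- the two KKT non-degeneracies of the NESTED system (displayed; at the wrapper `h1` is `Matrix.isUnit_det_of_right_inverse` on the F leg `hXF`, `h2` is #21-GB's (EFF) line)
    (h1 : (kkt H₀ (fromRows Q₁₀ τ₁)).det ≠ 0) (h2 : (kkt S.toBlocks₁₁ (fromRows Q₂₀ τ₂)).det ≠ 0)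
    (hTW : (Matrix.fromRows (τ₂ * Q₁₀) τ₁ * W₀).det ≠ 0)
    -- the coarse box and the leg letters for the record's chart
    (Mc : Fin (3 + 1) → ℕ) [∀ i, NeZero (Mc i)] (hMc : ∀ i, M' i = Lc * Mc i)
    (σ : Fib 3 → ℝ) (ρN : Site (3 + 1)) (LNc : ℕ) (fN : κ → Idx (towerTorus Lc M' (n + 1)) (Fib 3))
    (hEAN : perF (towerTorus Lc M' (n + 1)) (axEc ρN LNc) * perF (towerTorus Lc M' (n + 1)) (scaleK σ σ (AN R (n + 1))) = perF (towerTorus Lc M' (n + 1)) (scaleK σ σ (AN R (n + 1))))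
    (hLN : XN.submatrix (Sum.map id Sum.inl) (Sum.map id Sum.inl) = fromBlocks
      (Matrix.of fun (b b' : (↥(pbox (towerTorus Lc M' (n + 1))) × Fin (3 + 1))) =>
        axEc ρN LNc (b.1 : Site (3 + 1)) (b.1 : Site (3 + 1)) (Sum.inl b.2) (Sum.inl b.2)
          * (axEc ρN LNc (b'.1 : Site (3 + 1)) (b'.1 : Site (3 + 1)) (Sum.inl b'.2) (Sum.inl b'.2)
            * perF (towerTorus Lc M' (n + 1)) (scaleK σ σ (AN R (n + 1))) (b.1, Sum.inl b.2) (b'.1, Sum.inl b'.2)))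
      (Matrix.of fun (b : (↥(pbox (towerTorus Lc M' (n + 1))) × Fin (3 + 1))) (a : κ) =>
        axEc ρN LNc (b.1 : Site (3 + 1)) (b.1 : Site (3 + 1)) (Sum.inl b.2) (Sum.inl b.2) * perF (towerTorus Lc M' (n + 1)) (scaleK σ σ (AN R (n + 1))) (b.1, Sum.inl b.2) (fN a))
      (-Matrix.of fun (a : κ) (b : (↥(pbox (towerTorus Lc M' (n + 1))) × Fin (3 + 1))) =>
        axEc ρN LNc (b.1 : Site (3 + 1)) (b.1 : Site (3 + 1)) (Sum.inl b.2) (Sum.inl b.2) * perF (towerTorus Lc M' (n + 1)) (scaleK σ σ (AN R (n + 1))) (fN a) (b.1, Sum.inl b.2))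
      (-((perF (towerTorus Lc M' (n + 1)) (scaleK σ σ (AN R (n + 1)))).submatrix fN fN)))
    -- ONE slot pin (v10: `hfN n B a` with `w = ↑a.1`, `μ = a.2`)
    (a : κ) (w : Site (3 + 1)) (μ : Fin (3 + 1))
    (hfa : fN a = (wrapPt (towerTorus Lc M' (n + 1)) (((Lc ^ (n + 1 + 1) : ℕ) : ℤ) • w), Sum.inr μ)) (c : ℝ)
    -- v10's `hlve`-shaped DISPLAY of the tree-gauge function
    (lv : (κ → ℝ) → (↥(pbox (towerTorus Lc M' (n + 1))) → ℝ))
    (hlve : ∀ (v : κ → ℝ) (s : ↥(pbox (towerTorus Lc M' (n + 1)))), lv v s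
      = -(∑ x : Res (bigRoot Lc (fun _ : ℕ => ctrOff (3 + 1) Lc) (n + 1)) (bigRatio Lc (n + 1)) (towerTorus Lc M' (n + 1)),
          (if (x.1 : ↥(pbox (towerTorus Lc M' (n + 1)))) = s then
            (towerEvalC Lc M' (fun _ : ℕ => ctrOff (3 + 1) Lc) (fun k => toSite_mem_range (hrs k)) (n + 1)
              *ᵥ ((P * W₀)⁻¹ *ᵥ (P *ᵥ hv v))) (towerEquiv Lc M' (fun _ : ℕ => ctrOff (3 + 1) Lc) (fun k => toSite_mem_range (hrs k)) (n + 1) x) else 0)))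
    (s : ↥(pbox (towerTorus Lc M' (n + 1)))) :
    lv (c • (Pi.single a (1 : ℝ) : κ → ℝ)) s
      = c * ∑' m : Site (3 + 1), lamZ Lc lev (fun _ : ℕ => ctrOff (3 + 1) Lc) (fun k => toSite_mem_range (hrs k)) n (scaleK σ σ (AN R (n + 1))) μ
          (translate Mc w m) (s : Site (3 + 1)) := by
  have hθ := gaugeParam_eq_neg_nestedReadout_sym M' Lc lev n hrs hlev hM' pμ' mμ' hfμ' hcoarse' hH₀ hQ₁₀ hτ₁ hτ₂ hQ₂₀ hW₀ hP h𝔔₀ hI hS hhv hXN h1 h2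
    (c • (Pi.single a (1 : ℝ) : κ → ℝ))
  have hLb : ((bigRatio Lc (n + 1) : ℕ) : ℤ) = ((Lc ^ (n + 1 + 1) : ℕ) : ℤ) := by rw [bigRatio_eq_pow]
  have hA : ∀ t : Site (3 + 1), shiftK (-(((bigRatio Lc (n + 1) : ℕ) : ℤ) • t)) (scaleK σ σ (AN R (n + 1))) = scaleK σ σ (AN R (n + 1)) := fun t => by
    rw [hLb]; exact shiftK_scaleK_AN R (n + 1) σ σ t
  have hAs : ∀ (x : Site (3 + 1)) (κ' μ' : Fin (3 + 1)) (w' : Site (3 + 1)),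
      Summable (fun m : Site (3 + 1) => scaleK σ σ (AN R (n + 1)) x (((bigRatio Lc (n + 1) : ℕ) : ℤ) • translate Mc w' m) (Sum.inl κ') (Sum.inr μ')) :=
    fun x κ' μ' w' => by rw [hLb]; exact summable_scaleK_AN_inl_inr_copies R (n + 1) σ σ Mc x κ' μ' w'
  have hfa' : fN a = (wrapPt (towerTorus Lc M' (n + 1)) (((bigRatio Lc (n + 1) : ℕ) : ℤ) • w), Sum.inr μ) := by rw [hLb]; exact hfa
  exact lv_smul_single_eq_tsum_lamZ Lc M' lev (fun _ : ℕ => ctrOff (3 + 1) Lc) (fun k => toSite_mem_range (hrs k)) hM' n hQ₁₀ hτ₁ hτ₂ rfl hW₀ hTW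
    (det_refSlice_mul_towerGen_ne_zero Lc lev n (hrs 0)) Mc hMc ρN LNc (scaleK σ σ (AN R (n + 1))) hA hAs fN hEAN hLN a w μ hfa' c
    (fun v => (P * W₀)⁻¹ *ᵥ (P *ᵥ hv v)) hθ lv hlve s

end Record

end Summit.QuantumFields.BalabanUV.Beta.FP.TowerDoorGaugePeriodised

end
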